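/-
Copyright (c) 2026 the pub-hodgecm-mathlib formalisation cell (harness21).  Prover seat hodgecm-mathlib-K2E1-p10 (g2), Track B ∕ K2-LIT (build stream 29), h413 = `stmt-HodgeConjecture-24833`,
route of record `HCCMUnconditional`, ROADCARD «5Res ENDGAME BY FAMILIES» §2 C7; dealer K2E1-plan (g7) deals (155)∕(169)∕(217) — FILE F3b of the C7 split: the DICTIONARY between f1's
pseudo-Eisenstein series along `N` (right-coset currency) and the Borel-level `eisensteinSeriesU` (left currency) through the PERIODISATION over the rational torus.
-/
import Summits.HodgeConjecture.HodgeConjecture.Theorems.K2E1PseudoEisensteinCuspOrthogonal   -- ★ F2b (K2E1-p09): `memLp_two_pseudoEisenstein_automorphicQuotient` (the test class `𝒯_i`)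
import Summits.HodgeConjecture.HodgeConjecture.Theorems.K2E1BorelCosetsDictionary           -- ★ (K2E1-p08): `eisensteinSeriesU_eq_tsum_arithmeticBorelQuot`
import Literature.NumberTheory.Automorphic.UnitaryGroupKernelDictionary                   -- ★ `quotientSubgroup_quasiSplit`
import Literature.NumberTheory.Automorphic.AutomorphicRepsGLCuspidalUnitary               -- ★ `AdelicGroupData.quotFun`
import HarnessLib

/-!
# h413 ∕ Track B «K2-LIT», ROADCARD «5Res BY FAMILIES» C7, FILE F3b — helper `K2E1PseudoEisensteinBorelPeriodizationU2`: THE DICTIONARY `θ^N_Φ = quotFun (E Φ_B^∨)` — f1's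
# pseudo-Eisenstein series along `N` is the Borel Eisenstein series (★ `eisensteinSeriesU`) of the PERIODISATION `Φ_B(g) = Σ_{δ ∈ B(F)⧸(B(F)∩N(𝔸))} Φ(g δ)` read through `h ↦ h⁻¹`

Cell `pub/hodgecm-mathlib`, crux h413 = `stmt-HodgeConjecture-24833`, route of record `HCCMUnconditional`; dealer K2E1-plan (g7) (217) «F3a → F3b → F3d».  THEOREMS ONLY (no `def`, no `instance`,
no notation, no named-fact hypothesis, no `sorry`); lane `--supports stmt-HodgeConjecture-24833 --as helper` (count-neutral).  Closes no socket.  Mok's quasi-split `U(J_N)` for a quadratic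
datum `(F, E, c)` (★ `quasiSplit F E c N`; the CM pair is an instance); parabolic data HYPOTHESIS-FIRST as in ★ `K2E1CuspFormsMeanZeroSoftU`: `𝔓`, `i` with `h𝔓 : 𝔓.radical i = adelicUnipotent F E c N`.

THE TWO CURRENCIES.  ★ f1∕F2b∕F3a (this seat's `K2E1PseudoEisensteinKAverageU2`, `…TruncationDensityU`) speak on `X = G(𝔸) ⧸ Γ` (`Γ = 𝒢.quotientSubgroup = G(F)`, ★ `quotientSubgroup_quasiSplit`) of
`θ^N_Φ(x) = Σ'_{q ∈ Γ⧸(Γ ∩ N(𝔸))} Φ(x̃ q̃)` for RIGHT-`N(𝔸)`-invariant `Φ` (`x̃ = out x`); the Bernstein–Lapid ∕ (χ,τ) files (★ W-b, H-χ, D4′c, C9) speak of `E ψ = eisensteinSeriesU ψ = Σ'_{B(F)∖G(F)} ψ(γ ·)`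
for LEFT-`N(𝔸)B(F)`-invariant `ψ`, with `L²`-classes through ★ `quotFun` (`quotFun φ x = φ(x̃⁻¹)`).  THE DICTIONARY: with the periodisation over the rational torus
`Φ_B(g) := Σ'_{b ∈ B(F)⧸(B(F) ∩ N(𝔸))} Φ(g b̃)` (index `↥arithmeticBorel ⧸ …`; `B(F)⧸(B(F)∩N(𝔸)) ≅ T(F)`) and `ψ(h) := Φ_B(h⁻¹)`:
`θ^N_Φ(x) = Σ_{Γ⧸Γ_N} = Σ_{c ∈ Γ⧸Γ_B} Σ_{b ∈ Γ_B⧸Γ_N} Φ(x̃ c̃ b̃) = Σ_{c} Φ_B(x̃ c̃) = Σ_{B(F)γ} Φ_B(x̃ γ⁻¹) = E ψ (x̃⁻¹) = quotFun (E ψ) x` (Mathlib `Subgroup.quotientEquivProdOfLE`, `Summable.tsum_prod`,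
`QuotientGroup.quotientRightRelEquivQuotientLeftRel`, ★ `eisensteinSeriesU_eq_tsum_arithmeticBorelQuot`), valid at every `x` where the `Γ⧸Γ_N`-family is absolutely summable — a.e. for `Φ ∈ 𝒯_i`,
everywhere for `Φ` boundedly supported modulo `N(𝔸)` — and `ψ` is left-`N(𝔸)`- and left-`B(F)`-invariant, right-`K`-invariant when `Φ` is left-`K`-invariant.

* §1 `tsum_quotient_congr` (transport of f1's sum along `quotientSubgroup = arithmeticSubgroup`, `𝔓.radical i = N(𝔸)`), `apply_mul_out_eq_of_mk_eq` (representative independence).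
* §2 the periodisation: `periodization_mul_mem` (right-`B(F)`-invariance), `periodization_mul_unipotent` (right-`N(𝔸)`-invariance), `inv_periodization_borel_mul` ∕ `inv_periodization_unipotent_mul`
  (`ψ` is left-`B(F)`- and left-`N(𝔸)`-invariant), `inv_periodization_mul_right` (`ψ` right-`K`-invariant).
* §3 **`tsum_quotient_eq_quotFun_eisensteinSeriesU`** (the dictionary at a point of absolute summability), **`tsum_quotient_ae_eq_quotFun_eisensteinSeriesU`** (a.e. for `Φ ∈ 𝒯_i`),
  **`memLp_quotFun_eisensteinSeriesU_inv_periodization`**, **`toLp_pseudoEisenstein_eq_toLp_quotFun_eisensteinSeriesU`** (the `L²`-classes agree).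

HONEST LABEL: HC_CM is proved only modulo the 7 printed citations (2 remaining named inputs: hLiu418 = `stmt-HodgeConjecture-24832`, h413 = `stmt-HodgeConjecture-24833`) until rung 0
closes; this file asserts no named fact and closes no socket.
References: [MoeglinWaldspurger1995] C. Mœglin, J.-L. Waldspurger, *Spectral Decomposition and Eisenstein Series*, II.1.1–II.1.3 (pseudo-Eisenstein series along `P` and along `P₀`);
[Garrett2018] P. Garrett, *Modern Analysis of Automorphic Forms by Example*, §2.10, §1.8; [BorelJacquet1979] A. Borel, H. Jacquet, *Automorphic forms and automorphic representations*, §4.6.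
-/

set_option autoImplicit false
set_option linter.dupNamespace false  -- the mandated namespace repeats the summit's segment (`HodgeConjecture.HodgeConjecture`)

noncomputable section

open MeasureTheory Measure Set Filter Topology NumberField
open Literature.MeasureTheory.Group Literature.NumberTheory.Automorphic Literature.NumberTheory.Automorphic.UnitaryGroup AdelicGroupData
open Summit.HodgeConjecture.HodgeConjecture.Cruxes.H413.K2E1BorelEisensteinU
open Summit.HodgeConjecture.HodgeConjecture.Cruxes.H413.K2E1BorelCosetsDictionary (eisensteinSeriesU_eq_tsum_arithmeticBorelQuot)
open Summit.HodgeConjecture.HodgeConjecture.Cruxes.H413.K2E1PseudoEisensteinCuspOrthogonal (measurable_tsum_enorm memLp_two_pseudoEisenstein_automorphicQuotient)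
open scoped ENNReal NNReal

namespace Summit.HodgeConjecture.HodgeConjecture.Cruxes.H413.K2E1PseudoEisensteinBorelPeriodizationU2

variable {F E : Type} [Field F] [NumberField F] [Field E] [NumberField E] [Algebra F E] {c : E ≃ₐ[F] E} {N : ℕ}

/-! ## §1 Transport of f1's counting sum and representative independence -/

/-- **TRANSPORT**: the counting sum `Σ'_{q ∈ S⧸(R ∩ S)} f(q̃)` depends on the subgroups `S, R ≤ G(𝔸)` only through their values (used along ★ `quotientSubgroup_quasiSplit` and `𝔓.radical i = N(𝔸)`).
[folklore] -/
theorem tsum_quotient_congr {M : Type*} [AddCommMonoid M] [TopologicalSpace M] (f : (quasiSplit F E c N).Adelic → M)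
    {S S' : Subgroup (quasiSplit F E c N).Adelic} (hS : S = S') {R R' : Subgroup (quasiSplit F E c N).Adelic} (hR : R = R') :
    (∑' q : S ⧸ R.subgroupOf S, f ((q.out : S) : (quasiSplit F E c N).Adelic)) = ∑' q : S' ⧸ R'.subgroupOf S', f ((q.out : S') : (quasiSplit F E c N).Adelic) := by
  subst hS hR; rfl

/-- The same transport for (norm-)summability of the counting family. [folklore] -/
theorem summable_quotient_congr {M : Type*} [AddCommMonoid M] [TopologicalSpace M] (f : (quasiSplit F E c N).Adelic → M)
    {S S' : Subgroup (quasiSplit F E c N).Adelic} (hS : S = S') {R R' : Subgroup (quasiSplit F E c N).Adelic} (hR : R = R') :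
    Summable (fun q : S ⧸ R.subgroupOf S => f ((q.out : S) : (quasiSplit F E c N).Adelic)) ↔
      Summable (fun q : S' ⧸ R'.subgroupOf S' => f ((q.out : S') : (quasiSplit F E c N).Adelic)) := by
  subst hS hR; exact Iff.rfl

/-- **REPRESENTATIVE INDEPENDENCE** (any group): for `f` right-invariant under a subgroup `s`, `f (⟦a⟧.out) = f a`. [folklore] -/
theorem apply_out_mk {α M : Type*} [Group α] (s : Subgroup α) {f : α → M} (hf : ∀ (a : α) (r : s), f (a * r) = f a) (a : α) :
    f ((QuotientGroup.mk a : α ⧸ s).out) = f a := by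
  obtain ⟨r, hr⟩ := QuotientGroup.mk_out_eq_mul s a
  rw [hr, hf]

/-! ## §2 The periodisation `Φ_B(g) = Σ'_{b ∈ B(F)⧸(B(F) ∩ N(𝔸))} Φ(g b̃)` and `ψ(h) = Φ_B(h⁻¹)` -/

/-- `B(F) ∩ N(𝔸) ≤ B(F)` inside `G(F)`: the fibre subgroup of the periodisation (`N(𝔸) ≤ B(𝔸)`, ★ `adelicUnipotent_le_borelAdelic`). [cite: MoeglinWaldspurger1995, II.1.1] -/
theorem unipotent_subgroupOf_le_arithmeticBorel :
    (adelicUnipotent F E c N).subgroupOf (quasiSplit F E c N).arithmeticSubgroup ≤ arithmeticBorel F E c N := fun γ hγ =>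
  (mem_arithmeticBorel_iff γ).2 (adelicUnipotent_le_borelAdelic (Subgroup.mem_subgroupOf.1 hγ))

/-- A right-`N(𝔸)`-invariant `Φ` read on `B(F)`, `b ↦ Φ(g b)`, is right-invariant under the fibre subgroup `B(F) ∩ N(𝔸)`. [folklore] -/
theorem apply_mul_coe_mul_fibre {M : Type*} {Φ : (quasiSplit F E c N).Adelic → M} (hΦ : ∀ (g : (quasiSplit F E c N).Adelic) (u : adelicUnipotent F E c N), Φ (g * u) = Φ g)
    (g : (quasiSplit F E c N).Adelic) (b : arithmeticBorel F E c N)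
    (r : ((adelicUnipotent F E c N).subgroupOf (quasiSplit F E c N).arithmeticSubgroup).subgroupOf (arithmeticBorel F E c N)) :
    Φ (g * (((b * r : arithmeticBorel F E c N) : (quasiSplit F E c N).arithmeticSubgroup) : (quasiSplit F E c N).Adelic)) =
      Φ (g * (((b : arithmeticBorel F E c N) : (quasiSplit F E c N).arithmeticSubgroup) : (quasiSplit F E c N).Adelic)) := by
  have hr : ((((r : arithmeticBorel F E c N) : (quasiSplit F E c N).arithmeticSubgroup) : (quasiSplit F E c N).Adelic)) ∈ adelicUnipotent F E c N :=
    Subgroup.mem_subgroupOf.1 (Subgroup.mem_subgroupOf.1 r.2)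
  rw [Subgroup.coe_mul, Subgroup.coe_mul, ← mul_assoc]
  exact hΦ _ ⟨_, hr⟩

/-- **`Φ_B` IS RIGHT-`B(F)`-INVARIANT**: `Φ_B(g b₀) = Φ_B(g)` for `b₀ ∈ B(F)` — left multiplication by `b₀` permutes `B(F)⧸(B(F)∩N(𝔸))` (Mathlib `Equiv.tsum_eq`). [cite: MoeglinWaldspurger1995, II.1.1] -/
theorem periodization_mul_arithmeticBorel {Φ : (quasiSplit F E c N).Adelic → ℂ} (hΦ : ∀ (g : (quasiSplit F E c N).Adelic) (u : adelicUnipotent F E c N), Φ (g * u) = Φ g)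
    (g : (quasiSplit F E c N).Adelic) (b₀ : arithmeticBorel F E c N) :
    (∑' b : ↥(arithmeticBorel F E c N) ⧸ ((adelicUnipotent F E c N).subgroupOf (quasiSplit F E c N).arithmeticSubgroup).subgroupOf (arithmeticBorel F E c N),
        Φ (g * ((b₀ : (quasiSplit F E c N).arithmeticSubgroup) : (quasiSplit F E c N).Adelic) * (((b.out : arithmeticBorel F E c N) : (quasiSplit F E c N).arithmeticSubgroup) : (quasiSplit F E c N).Adelic))) =
      ∑' b : ↥(arithmeticBorel F E c N) ⧸ ((adelicUnipotent F E c N).subgroupOf (quasiSplit F E c N).arithmeticSubgroup).subgroupOf (arithmeticBorel F E c N),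
        Φ (g * (((b.out : arithmeticBorel F E c N) : (quasiSplit F E c N).arithmeticSubgroup) : (quasiSplit F E c N).Adelic)) := by
  set H := ((adelicUnipotent F E c N).subgroupOf (quasiSplit F E c N).arithmeticSubgroup).subgroupOf (arithmeticBorel F E c N) with hH
  -- `f b := Φ(g b)` on `B(F)` is right-`H`-invariant
  have hf : ∀ (a : arithmeticBorel F E c N) (r : H), (fun a : arithmeticBorel F E c N => Φ (g * ((a : (quasiSplit F E c N).arithmeticSubgroup) : (quasiSplit F E c N).Adelic))) (a * r) =
      (fun a : arithmeticBorel F E c N => Φ (g * ((a : (quasiSplit F E c N).arithmeticSubgroup) : (quasiSplit F E c N).Adelic))) a := fun a r => apply_mul_coe_mul_fibre hΦ g a r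
  rw [← (MulAction.toPerm b₀ : Equiv.Perm (↥(arithmeticBorel F E c N) ⧸ H)).tsum_eq
    (fun b : ↥(arithmeticBorel F E c N) ⧸ H => Φ (g * (((b.out : arithmeticBorel F E c N) : (quasiSplit F E c N).arithmeticSubgroup) : (quasiSplit F E c N).Adelic)))]
  refine tsum_congr fun b => ?_
  have hb : (MulAction.toPerm b₀ b : ↥(arithmeticBorel F E c N) ⧸ H) = QuotientGroup.mk (b₀ * b.out) := by
    rw [MulAction.toPerm_apply]
    conv_lhs => rw [← QuotientGroup.out_eq' b]
    rfl
  rw [hb]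
  have h2 := apply_out_mk H (f := fun a : arithmeticBorel F E c N => Φ (g * ((a : (quasiSplit F E c N).arithmeticSubgroup) : (quasiSplit F E c N).Adelic))) hf (b₀ * b.out)
  calc Φ (g * ((b₀ : (quasiSplit F E c N).arithmeticSubgroup) : (quasiSplit F E c N).Adelic) * (((b.out : arithmeticBorel F E c N) : (quasiSplit F E c N).arithmeticSubgroup) : (quasiSplit F E c N).Adelic))
      = Φ (g * (((b₀ * b.out : arithmeticBorel F E c N) : (quasiSplit F E c N).arithmeticSubgroup) : (quasiSplit F E c N).Adelic)) := by
        rw [Subgroup.coe_mul, Subgroup.coe_mul, mul_assoc]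
    _ = _ := h2.symm

/-- **`Φ_B` IS RIGHT-`N(𝔸)`-INVARIANT** (`N(𝔸)` is normalised by `B(F) ≤ B(𝔸)`, ★ `conj_mem_adelicUnipotent`). [cite: MoeglinWaldspurger1995, II.1.1] -/
theorem periodization_mul_unipotent {Φ : (quasiSplit F E c N).Adelic → ℂ} (hΦ : ∀ (g : (quasiSplit F E c N).Adelic) (u : adelicUnipotent F E c N), Φ (g * u) = Φ g)
    (g : (quasiSplit F E c N).Adelic) (u : adelicUnipotent F E c N) :
    (∑' b : ↥(arithmeticBorel F E c N) ⧸ ((adelicUnipotent F E c N).subgroupOf (quasiSplit F E c N).arithmeticSubgroup).subgroupOf (arithmeticBorel F E c N),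
        Φ (g * (u : (quasiSplit F E c N).Adelic) * (((b.out : arithmeticBorel F E c N) : (quasiSplit F E c N).arithmeticSubgroup) : (quasiSplit F E c N).Adelic))) =
      ∑' b : ↥(arithmeticBorel F E c N) ⧸ ((adelicUnipotent F E c N).subgroupOf (quasiSplit F E c N).arithmeticSubgroup).subgroupOf (arithmeticBorel F E c N),
        Φ (g * (((b.out : arithmeticBorel F E c N) : (quasiSplit F E c N).arithmeticSubgroup) : (quasiSplit F E c N).Adelic)) := by
  refine tsum_congr fun b => ?_
  set β : (quasiSplit F E c N).Adelic := (((b.out : arithmeticBorel F E c N) : (quasiSplit F E c N).arithmeticSubgroup) : (quasiSplit F E c N).Adelic) with hβ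
  have hβB : β ∈ borelAdelic F E c N := (mem_arithmeticBorel_iff _).1 (b.out : arithmeticBorel F E c N).2
  have hconj : β⁻¹ * (u : (quasiSplit F E c N).Adelic) * β ∈ adelicUnipotent F E c N := conj_mem_adelicUnipotent hβB u.2
  have h1 : g * (u : (quasiSplit F E c N).Adelic) * β = g * β * (β⁻¹ * (u : (quasiSplit F E c N).Adelic) * β) := by group
  rw [h1]
  exact hΦ (g * β) ⟨_, hconj⟩

/-- **`ψ(h) := Φ_B(h⁻¹)` IS LEFT-`B(F)`-INVARIANT** (Track-A spelling, the hypothesis of ★ `eisensteinSeriesU_eq_tsum_arithmeticBorelQuot`). [cite: Garrett2018, §2.10] -/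
theorem inv_periodization_borel_mul {Φ : (quasiSplit F E c N).Adelic → ℂ} (hΦ : ∀ (g : (quasiSplit F E c N).Adelic) (u : adelicUnipotent F E c N), Φ (g * u) = Φ g) :
    ∀ b ∈ arithmeticBorel F E c N, ∀ h : (quasiSplit F E c N).Adelic,
      (fun h : (quasiSplit F E c N).Adelic => ∑' q : ↥(arithmeticBorel F E c N) ⧸ ((adelicUnipotent F E c N).subgroupOf (quasiSplit F E c N).arithmeticSubgroup).subgroupOf (arithmeticBorel F E c N),
          Φ (h⁻¹ * (((q.out : arithmeticBorel F E c N) : (quasiSplit F E c N).arithmeticSubgroup) : (quasiSplit F E c N).Adelic))) ((b : (quasiSplit F E c N).Adelic) * h) =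
        (fun h : (quasiSplit F E c N).Adelic => ∑' q : ↥(arithmeticBorel F E c N) ⧸ ((adelicUnipotent F E c N).subgroupOf (quasiSplit F E c N).arithmeticSubgroup).subgroupOf (arithmeticBorel F E c N),
          Φ (h⁻¹ * (((q.out : arithmeticBorel F E c N) : (quasiSplit F E c N).arithmeticSubgroup) : (quasiSplit F E c N).Adelic))) h := by
  intro b hb h
  show (∑' q, Φ (((b : (quasiSplit F E c N).Adelic) * h)⁻¹ * _)) = ∑' q, Φ (h⁻¹ * _)
  have h1 : ((b : (quasiSplit F E c N).Adelic) * h)⁻¹ = h⁻¹ * (((⟨b, hb⟩⁻¹ : arithmeticBorel F E c N) : (quasiSplit F E c N).arithmeticSubgroup) : (quasiSplit F E c N).Adelic) := by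
    rw [mul_inv_rev]; rfl
  simp_rw [h1]
  exact periodization_mul_arithmeticBorel hΦ h⁻¹ ⟨b, hb⟩⁻¹

/-- **`ψ` IS LEFT-`N(𝔸)`-INVARIANT**. [cite: MoeglinWaldspurger1995, II.1.1] -/
theorem inv_periodization_unipotent_mul {Φ : (quasiSplit F E c N).Adelic → ℂ} (hΦ : ∀ (g : (quasiSplit F E c N).Adelic) (u : adelicUnipotent F E c N), Φ (g * u) = Φ g)
    (u : adelicUnipotent F E c N) (h : (quasiSplit F E c N).Adelic) :
    (fun h : (quasiSplit F E c N).Adelic => ∑' q : ↥(arithmeticBorel F E c N) ⧸ ((adelicUnipotent F E c N).subgroupOf (quasiSplit F E c N).arithmeticSubgroup).subgroupOf (arithmeticBorel F E c N),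
        Φ (h⁻¹ * (((q.out : arithmeticBorel F E c N) : (quasiSplit F E c N).arithmeticSubgroup) : (quasiSplit F E c N).Adelic))) ((u : (quasiSplit F E c N).Adelic) * h) =
      (fun h : (quasiSplit F E c N).Adelic => ∑' q : ↥(arithmeticBorel F E c N) ⧸ ((adelicUnipotent F E c N).subgroupOf (quasiSplit F E c N).arithmeticSubgroup).subgroupOf (arithmeticBorel F E c N),
        Φ (h⁻¹ * (((q.out : arithmeticBorel F E c N) : (quasiSplit F E c N).arithmeticSubgroup) : (quasiSplit F E c N).Adelic))) h := by
  show (∑' q, Φ (((u : (quasiSplit F E c N).Adelic) * h)⁻¹ * _)) = ∑' q, Φ (h⁻¹ * _)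
  have h1 : ((u : (quasiSplit F E c N).Adelic) * h)⁻¹ = h⁻¹ * ((u⁻¹ : adelicUnipotent F E c N) : (quasiSplit F E c N).Adelic) := by
    rw [mul_inv_rev]; rfl
  simp_rw [h1]
  exact periodization_mul_unipotent hΦ h⁻¹ u⁻¹

/-- **`ψ` IS RIGHT-`K`-INVARIANT WHEN `Φ` IS LEFT-`K`-INVARIANT** (`K` acting through any homomorphism `ι`). [folklore] -/
theorem inv_periodization_mul_right {Kc : Type*} [Group Kc] (ι : Kc →* (quasiSplit F E c N).Adelic) {Φ : (quasiSplit F E c N).Adelic → ℂ}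
    (hK : ∀ (k : Kc) (g : (quasiSplit F E c N).Adelic), Φ (ι k * g) = Φ g) (h : (quasiSplit F E c N).Adelic) (k : Kc) :
    (fun h : (quasiSplit F E c N).Adelic => ∑' q : ↥(arithmeticBorel F E c N) ⧸ ((adelicUnipotent F E c N).subgroupOf (quasiSplit F E c N).arithmeticSubgroup).subgroupOf (arithmeticBorel F E c N),
        Φ (h⁻¹ * (((q.out : arithmeticBorel F E c N) : (quasiSplit F E c N).arithmeticSubgroup) : (quasiSplit F E c N).Adelic))) (h * ι k) =
      (fun h : (quasiSplit F E c N).Adelic => ∑' q : ↥(arithmeticBorel F E c N) ⧸ ((adelicUnipotent F E c N).subgroupOf (quasiSplit F E c N).arithmeticSubgroup).subgroupOf (arithmeticBorel F E c N),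
        Φ (h⁻¹ * (((q.out : arithmeticBorel F E c N) : (quasiSplit F E c N).arithmeticSubgroup) : (quasiSplit F E c N).Adelic))) h := by
  show (∑' q, Φ ((h * ι k)⁻¹ * _)) = ∑' q, Φ (h⁻¹ * _)
  refine tsum_congr fun q => ?_
  rw [mul_inv_rev, ← map_inv, mul_assoc, hK]

/-! ## §3 The dictionary `θ^N_Φ(x) = quotFun (E ψ) x` -/

/-- **THE DICTIONARY, ARITHMETIC FORM**: if the family `γ ↦ Φ(g γ)`, `γ ∈ G(F)⧸(G(F) ∩ N(𝔸))`, is absolutely summable, then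
`Σ'_{q ∈ G(F)⧸(G(F)∩N(𝔸))} Φ(g q̃) = eisensteinSeriesU ψ (g⁻¹)` with `ψ(h) = Φ_B(h⁻¹)` — split `G(F)⧸(G(F)∩N(𝔸)) ≃ (G(F)⧸B(F)) × (B(F)⧸(B(F)∩N(𝔸)))`
(Mathlib `Subgroup.quotientEquivProdOfLE`), sum fibrewise (`Summable.tsum_prod`), pass from left to right cosets of `B(F)` by inversion (`QuotientGroup.quotientRightRelEquivQuotientLeftRel`)
and read the result as ★ `eisensteinSeriesU_eq_tsum_arithmeticBorelQuot`. [cite: MoeglinWaldspurger1995, II.1.1–II.1.3] [cite: Garrett2018, §2.10] -/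
theorem tsum_arithmetic_quotient_eq_eisensteinSeriesU {Φ : (quasiSplit F E c N).Adelic → ℂ}
    (hΦ : ∀ (g : (quasiSplit F E c N).Adelic) (u : adelicUnipotent F E c N), Φ (g * u) = Φ g) (g : (quasiSplit F E c N).Adelic)
    (hsum : Summable fun q : ↥(quasiSplit F E c N).arithmeticSubgroup ⧸ (adelicUnipotent F E c N).subgroupOf (quasiSplit F E c N).arithmeticSubgroup =>
      ‖Φ (g * ((q.out : (quasiSplit F E c N).arithmeticSubgroup) : (quasiSplit F E c N).Adelic))‖) :
    (∑' q : ↥(quasiSplit F E c N).arithmeticSubgroup ⧸ (adelicUnipotent F E c N).subgroupOf (quasiSplit F E c N).arithmeticSubgroup,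
        Φ (g * ((q.out : (quasiSplit F E c N).arithmeticSubgroup) : (quasiSplit F E c N).Adelic))) =
      eisensteinSeriesU (fun h : (quasiSplit F E c N).Adelic =>
        ∑' q : ↥(arithmeticBorel F E c N) ⧸ ((adelicUnipotent F E c N).subgroupOf (quasiSplit F E c N).arithmeticSubgroup).subgroupOf (arithmeticBorel F E c N),
          Φ (h⁻¹ * (((q.out : arithmeticBorel F E c N) : (quasiSplit F E c N).arithmeticSubgroup) : (quasiSplit F E c N).Adelic))) g⁻¹ := by
  -- abbreviations
  set Γa : Subgroup (quasiSplit F E c N).Adelic := (quasiSplit F E c N).arithmeticSubgroup with hΓa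
  set Na : Subgroup Γa := (adelicUnipotent F E c N).subgroupOf Γa with hNa
  set ΓB : Subgroup Γa := arithmeticBorel F E c N with hΓB
  have hle : Na ≤ ΓB := unipotent_subgroupOf_le_arithmeticBorel
  -- the integrand on `G(F)` and its right-`N`-invariance
  set f : Γa → ℂ := fun γ => Φ (g * (γ : (quasiSplit F E c N).Adelic)) with hf
  have hfN : ∀ (a : Γa) (r : Na), f (a * r) = f a := fun a r => by
    simp only [hf, Subgroup.coe_mul, ← mul_assoc]
    exact hΦ _ ⟨_, Subgroup.mem_subgroupOf.1 r.2⟩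
  -- Step 1: reindex along `Γa ⧸ Na ≃ (Γa ⧸ ΓB) × (ΓB ⧸ Na.subgroupOf ΓB)`
  set e := Subgroup.quotientEquivProdOfLE hle with he
  have hterm : ∀ p : (Γa ⧸ ΓB) × (↥ΓB ⧸ Na.subgroupOf ΓB), f (e.symm p).out = Φ (g * (p.1.out : (quasiSplit F E c N).Adelic) * ((p.2.out : ΓB) : Γa)) := by
    rintro ⟨cc, b⟩
    have hb : e.symm (cc, b) = QuotientGroup.mk (cc.out * ((b.out : ΓB) : Γa)) := by
      conv_lhs => rw [← QuotientGroup.out_eq' b]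
      rw [he, Subgroup.quotientEquivProdOfLE_symm_apply]
      rfl
    rw [hb, apply_out_mk Na hfN]
    simp only [hf, Subgroup.coe_mul, mul_assoc]
  have hsum' : Summable fun q : Γa ⧸ Na => f q.out := .of_norm hsum
  have hsumP : Summable fun p : (Γa ⧸ ΓB) × (↥ΓB ⧸ Na.subgroupOf ΓB) => f (e.symm p).out := (e.symm.summable_iff (f := fun q : Γa ⧸ Na => f q.out)).2 hsum'
  -- Step 2 data: right cosets by inversion; the right-`B(F)`-invariance of `Φ_B`
  set e₂ := QuotientGroup.quotientRightRelEquivQuotientLeftRel ΓB with he₂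
  have hΦB : ∀ (a : Γa) (r : ΓB), (fun a : Γa => ∑' b : ↥ΓB ⧸ Na.subgroupOf ΓB, Φ (g * (a : (quasiSplit F E c N).Adelic) * ((b.out : ΓB) : Γa))) (a * r) =
      (fun a : Γa => ∑' b : ↥ΓB ⧸ Na.subgroupOf ΓB, Φ (g * (a : (quasiSplit F E c N).Adelic) * ((b.out : ΓB) : Γa))) a := fun a r => by
    dsimp only
    rw [Subgroup.coe_mul, ← mul_assoc]
    exact periodization_mul_arithmeticBorel hΦ (g * (a : (quasiSplit F E c N).Adelic)) r
  have hq : ∀ q : Quotient (QuotientGroup.rightRel ΓB), e₂ q = QuotientGroup.mk (q.out)⁻¹ := fun q => by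
    conv_lhs => rw [← Quotient.out_eq' q]
    rfl
  calc ∑' q : Γa ⧸ Na, Φ (g * ((q.out : Γa) : (quasiSplit F E c N).Adelic))
      = ∑' p : (Γa ⧸ ΓB) × (↥ΓB ⧸ Na.subgroupOf ΓB), f (e.symm p).out := (e.symm.tsum_eq (fun q : Γa ⧸ Na => f q.out)).symm
    _ = ∑' (cc : Γa ⧸ ΓB) (b : ↥ΓB ⧸ Na.subgroupOf ΓB), Φ (g * (cc.out : (quasiSplit F E c N).Adelic) * ((b.out : ΓB) : Γa)) := by
        rw [hsumP.tsum_prod]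
        exact tsum_congr fun cc => tsum_congr fun b => hterm (cc, b)
    _ = ∑' (q : Quotient (QuotientGroup.rightRel ΓB)) (b : ↥ΓB ⧸ Na.subgroupOf ΓB),
          Φ (g * ((q.out : Γa) : (quasiSplit F E c N).Adelic)⁻¹ * ((b.out : ΓB) : Γa)) := by
        rw [← e₂.tsum_eq]
        refine tsum_congr fun q => ?_
        have h3 := apply_out_mk ΓB (f := fun a : Γa => ∑' b : ↥ΓB ⧸ Na.subgroupOf ΓB, Φ (g * (a : (quasiSplit F E c N).Adelic) * ((b.out : ΓB) : Γa))) hΦB (q.out)⁻¹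
        simp only [Subgroup.coe_inv] at h3
        rw [hq q]
        exact h3
    _ = eisensteinSeriesU (fun h : (quasiSplit F E c N).Adelic =>
          ∑' q : ↥(arithmeticBorel F E c N) ⧸ ((adelicUnipotent F E c N).subgroupOf (quasiSplit F E c N).arithmeticSubgroup).subgroupOf (arithmeticBorel F E c N),
            Φ (h⁻¹ * (((q.out : arithmeticBorel F E c N) : (quasiSplit F E c N).arithmeticSubgroup) : (quasiSplit F E c N).Adelic))) g⁻¹ := by
        rw [eisensteinSeriesU_eq_tsum_arithmeticBorelQuot (inv_periodization_borel_mul hΦ) g⁻¹]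
        exact tsum_congr fun q => tsum_congr fun b => by rw [mul_inv_rev, inv_inv]

variable (𝔓 : (quasiSplit F E c N).ParabolicUnipotentData) (i : 𝔓.ι) (h𝔓 : 𝔓.radical i = adelicUnipotent F E c N)

include h𝔓 in
/-- **THE DICTIONARY IN f1's CURRENCY, POINTWISE**: at every `x ∈ X = G(𝔸) ⧸ Γ` where f1's counting family `q ↦ Φ(x̃ q̃)` (`q ∈ Γ⧸(Γ ∩ N_i(𝔸))`, `Γ = 𝒢.quotientSubgroup`) is absolutely summable,
`θ^N_Φ(x) = quotFun (eisensteinSeriesU ψ) x` with `ψ(h) = Φ_B(h⁻¹)` (§1 transport along ★ `quotientSubgroup_quasiSplit` and `h𝔓`, then `tsum_arithmetic_quotient_eq_eisensteinSeriesU`).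
[cite: MoeglinWaldspurger1995, II.1.1–II.1.3] -/
theorem tsum_quotient_eq_quotFun_eisensteinSeriesU {Φ : (quasiSplit F E c N).Adelic → ℂ} (hΦ : ∀ (g : (quasiSplit F E c N).Adelic) (u : 𝔓.radical i), Φ (g * u) = Φ g)
    (x : (quasiSplit F E c N).automorphicQuotient)
    (hsum : Summable fun q : (quasiSplit F E c N).quotientSubgroup ⧸ (𝔓.radical i).subgroupOf (quasiSplit F E c N).quotientSubgroup =>
      ‖Φ ((Quotient.out x : (quasiSplit F E c N).Adelic) * ((q.out : (quasiSplit F E c N).quotientSubgroup) : (quasiSplit F E c N).Adelic))‖) :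
    (∑' q : (quasiSplit F E c N).quotientSubgroup ⧸ (𝔓.radical i).subgroupOf (quasiSplit F E c N).quotientSubgroup,
        Φ ((Quotient.out x : (quasiSplit F E c N).Adelic) * ((q.out : (quasiSplit F E c N).quotientSubgroup) : (quasiSplit F E c N).Adelic))) =
      (quasiSplit F E c N).quotFun (eisensteinSeriesU (fun h : (quasiSplit F E c N).Adelic =>
        ∑' q : ↥(arithmeticBorel F E c N) ⧸ ((adelicUnipotent F E c N).subgroupOf (quasiSplit F E c N).arithmeticSubgroup).subgroupOf (arithmeticBorel F E c N),
          Φ (h⁻¹ * (((q.out : arithmeticBorel F E c N) : (quasiSplit F E c N).arithmeticSubgroup) : (quasiSplit F E c N).Adelic)))) x := by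
  have hΦ' : ∀ (g : (quasiSplit F E c N).Adelic) (u : adelicUnipotent F E c N), Φ (g * u) = Φ g := fun g u => hΦ g ⟨u, by rw [h𝔓]; exact u.2⟩
  rw [tsum_quotient_congr (fun γ => Φ ((Quotient.out x : (quasiSplit F E c N).Adelic) * γ)) quotientSubgroup_quasiSplit h𝔓]
  rw [summable_quotient_congr (fun γ => ‖Φ ((Quotient.out x : (quasiSplit F E c N).Adelic) * γ)‖) quotientSubgroup_quasiSplit h𝔓] at hsum
  exact tsum_arithmetic_quotient_eq_eisensteinSeriesU hΦ' _ hsum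

/-! ## §4 For `Φ ∈ 𝒯_i`: the dictionary a.e., and the `L²(X)`-classes agree -/

section Classes

variable [MeasurableSpace (quasiSplit F E c N).Adelic] [BorelSpace (quasiSplit F E c N).Adelic]
  (μ : Measure (quasiSplit F E c N).automorphicQuotient) [(quasiSplit F E c N).IsAutomorphicMeasure μ]

include h𝔓 in
omit [(quasiSplit F E c N).IsAutomorphicMeasure μ] in
/-- **THE DICTIONARY HOLDS A.E. FOR `Φ ∈ 𝒯_i`**: `∫⁻ θ_{|Φ|}² dμ < ∞` makes f1's counting family absolutely summable at a.e. `x`, so `θ^N_Φ = quotFun (eisensteinSeriesU ψ)` `μ`-a.e.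
[cite: MoeglinWaldspurger1995, II.1.2] -/
theorem tsum_quotient_ae_eq_quotFun_eisensteinSeriesU {Φ : (quasiSplit F E c N).Adelic → ℂ} (hΦm : Measurable Φ) (hΦ : ∀ (g : (quasiSplit F E c N).Adelic) (u : 𝔓.radical i), Φ (g * u) = Φ g)
    (h2 : ∫⁻ x, (∑' q : (quasiSplit F E c N).quotientSubgroup ⧸ (𝔓.radical i).subgroupOf (quasiSplit F E c N).quotientSubgroup,
        ‖Φ ((Quotient.out x : (quasiSplit F E c N).Adelic) * ((q.out : (quasiSplit F E c N).quotientSubgroup) : (quasiSplit F E c N).Adelic))‖ₑ) ^ 2 ∂μ < ∞) :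
    (fun x : (quasiSplit F E c N).automorphicQuotient => ∑' q : (quasiSplit F E c N).quotientSubgroup ⧸ (𝔓.radical i).subgroupOf (quasiSplit F E c N).quotientSubgroup,
        Φ ((Quotient.out x : (quasiSplit F E c N).Adelic) * ((q.out : (quasiSplit F E c N).quotientSubgroup) : (quasiSplit F E c N).Adelic))) =ᵐ[μ]
      (quasiSplit F E c N).quotFun (eisensteinSeriesU (fun h : (quasiSplit F E c N).Adelic =>
        ∑' q : ↥(arithmeticBorel F E c N) ⧸ ((adelicUnipotent F E c N).subgroupOf (quasiSplit F E c N).arithmeticSubgroup).subgroupOf (arithmeticBorel F E c N),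
          Φ (h⁻¹ * (((q.out : arithmeticBorel F E c N) : (quasiSplit F E c N).arithmeticSubgroup) : (quasiSplit F E c N).Adelic)))) := by
  haveI := t2Space_adeleRing_of_numberField E
  haveI := locallyCompactSpace_adeleRing' E
  haveI := secondCountableTopology_adeleRing E
  haveI : LocallyCompactSpace (quasiSplit F E c N).Adelic := inferInstanceAs (LocallyCompactSpace (adelic F E c N ((StdForm.antidiagonal N).over E)))
  haveI : SecondCountableTopology (quasiSplit F E c N).Adelic := inferInstanceAs (SecondCountableTopology (adelic F E c N ((StdForm.antidiagonal N).over E)))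
  haveI : T2Space (quasiSplit F E c N).Adelic := inferInstanceAs (T2Space (adelic F E c N ((StdForm.antidiagonal N).over E)))
  haveI : DiscreteTopology (quasiSplit F E c N).quotientSubgroup := by rw [quotientSubgroup_quasiSplit]; exact isDiscreteRational_quasiSplit
  have hθm : Measurable fun x : (quasiSplit F E c N).automorphicQuotient => ∑' q : (quasiSplit F E c N).quotientSubgroup ⧸ (𝔓.radical i).subgroupOf (quasiSplit F E c N).quotientSubgroup,
      ‖Φ ((Quotient.out x : (quasiSplit F E c N).Adelic) * ((q.out : (quasiSplit F E c N).quotientSubgroup) : (quasiSplit F E c N).Adelic))‖ₑ := by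
    letI := AdelicGroupData.measurableSpaceQuotientForm (quasiSplit F E c N)
    haveI := AdelicGroupData.borelSpaceQuotientForm (quasiSplit F E c N)
    exact measurable_tsum_enorm (quasiSplit F E c N).quotientSubgroup (𝔓.radical i) hΦm hΦ
  filter_upwards [ae_lt_top (hθm.pow_const 2) h2.ne] with x hx
  have hfin : (∑' q : (quasiSplit F E c N).quotientSubgroup ⧸ (𝔓.radical i).subgroupOf (quasiSplit F E c N).quotientSubgroup,
      ‖Φ ((Quotient.out x : (quasiSplit F E c N).Adelic) * ((q.out : (quasiSplit F E c N).quotientSubgroup) : (quasiSplit F E c N).Adelic))‖ₑ) ≠ ∞ := fun h =>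
    (lt_top_iff_ne_top.1 hx) (by rw [h, ENNReal.top_pow]; exact two_ne_zero)
  have hs : Summable fun q : (quasiSplit F E c N).quotientSubgroup ⧸ (𝔓.radical i).subgroupOf (quasiSplit F E c N).quotientSubgroup =>
      ‖Φ ((Quotient.out x : (quasiSplit F E c N).Adelic) * ((q.out : (quasiSplit F E c N).quotientSubgroup) : (quasiSplit F E c N).Adelic))‖₊ := by
    refine ENNReal.tsum_coe_ne_top_iff_summable.1 ?_
    simpa only [enorm_eq_nnnorm] using hfin
  exact tsum_quotient_eq_quotFun_eisensteinSeriesU 𝔓 i h𝔓 hΦ x (by simpa only [coe_nnnorm] using NNReal.summable_coe.2 hs)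

include h𝔓 in
/-- **`quotFun (eisensteinSeriesU ψ) ∈ L²(X, μ)`** for `Φ ∈ 𝒯_i` (it agrees a.e. with `θ^N_Φ ∈ L²`, ★ F2b). [cite: MoeglinWaldspurger1995, II.1.2] -/
theorem memLp_quotFun_eisensteinSeriesU_inv_periodization {Φ : (quasiSplit F E c N).Adelic → ℂ} (hΦm : Measurable Φ)
    (hΦ : ∀ (g : (quasiSplit F E c N).Adelic) (u : 𝔓.radical i), Φ (g * u) = Φ g)
    (h2 : ∫⁻ x, (∑' q : (quasiSplit F E c N).quotientSubgroup ⧸ (𝔓.radical i).subgroupOf (quasiSplit F E c N).quotientSubgroup,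
        ‖Φ ((Quotient.out x : (quasiSplit F E c N).Adelic) * ((q.out : (quasiSplit F E c N).quotientSubgroup) : (quasiSplit F E c N).Adelic))‖ₑ) ^ 2 ∂μ < ∞)
    [LocallyCompactSpace (quasiSplit F E c N).Adelic] [SecondCountableTopology (quasiSplit F E c N).Adelic] [T2Space (quasiSplit F E c N).Adelic] [DiscreteTopology (quasiSplit F E c N).quotientSubgroup] :
    MemLp ((quasiSplit F E c N).quotFun (eisensteinSeriesU (fun h : (quasiSplit F E c N).Adelic =>
        ∑' q : ↥(arithmeticBorel F E c N) ⧸ ((adelicUnipotent F E c N).subgroupOf (quasiSplit F E c N).arithmeticSubgroup).subgroupOf (arithmeticBorel F E c N),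
          Φ (h⁻¹ * (((q.out : arithmeticBorel F E c N) : (quasiSplit F E c N).arithmeticSubgroup) : (quasiSplit F E c N).Adelic))))) 2 μ :=
  (memLp_two_pseudoEisenstein_automorphicQuotient (quasiSplit F E c N) 𝔓 i μ hΦm hΦ h2).ae_eq (tsum_quotient_ae_eq_quotFun_eisensteinSeriesU 𝔓 i h𝔓 μ hΦm hΦ h2)

include h𝔓 in
/-- **THE `L²(X)`-CLASSES AGREE: `[θ^N_Φ] = [quotFun (eisensteinSeriesU ψ)]`** for `Φ ∈ 𝒯_i` — the bridge from ★ F2b∕F3a's generators (f1's currency) to the Bernstein–Lapid ∕ (χ,τ) currency of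
★ W-b, H-χ, D4′c and C9. [cite: MoeglinWaldspurger1995, II.1.1–II.1.3] -/
theorem toLp_pseudoEisenstein_eq_toLp_quotFun_eisensteinSeriesU {Φ : (quasiSplit F E c N).Adelic → ℂ} (hΦm : Measurable Φ)
    (hΦ : ∀ (g : (quasiSplit F E c N).Adelic) (u : 𝔓.radical i), Φ (g * u) = Φ g)
    (h2 : ∫⁻ x, (∑' q : (quasiSplit F E c N).quotientSubgroup ⧸ (𝔓.radical i).subgroupOf (quasiSplit F E c N).quotientSubgroup,
        ‖Φ ((Quotient.out x : (quasiSplit F E c N).Adelic) * ((q.out : (quasiSplit F E c N).quotientSubgroup) : (quasiSplit F E c N).Adelic))‖ₑ) ^ 2 ∂μ < ∞)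
    [LocallyCompactSpace (quasiSplit F E c N).Adelic] [SecondCountableTopology (quasiSplit F E c N).Adelic] [T2Space (quasiSplit F E c N).Adelic] [DiscreteTopology (quasiSplit F E c N).quotientSubgroup] :
    (memLp_two_pseudoEisenstein_automorphicQuotient (quasiSplit F E c N) 𝔓 i μ hΦm hΦ h2).toLp _ =
      (memLp_quotFun_eisensteinSeriesU_inv_periodization 𝔓 i h𝔓 μ hΦm hΦ h2).toLp _ :=
  MemLp.toLp_congr _ _ (tsum_quotient_ae_eq_quotFun_eisensteinSeriesU 𝔓 i h𝔓 μ hΦm hΦ h2)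

end Classes

end Summit.HodgeConjecture.HodgeConjecture.Cruxes.H413.K2E1PseudoEisensteinBorelPeriodizationU2

end
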